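import Summits.CriticalPhenomena.PercolationContinuityZ3.Theorems.PercNearOneGluingNoHeavyLowerTailSahiCombTriWAndLattice

/-!
# Lattice row atoms for AND-products, II: threefold conjunctions / disjunctions of section indicators

Support file of the one-cut programme (crux `NoHeavyLowerTail`, stmt-CriticalPhenomena-4575; unit `prim-lf-1` gen 45, memo
`FROM-prim-lf-1-gen45-AND-OR3.md` §4).  Continuation of `…SahiCombTriWAndLattice` (`iAnd`, `iOr`): the blocks on four coordinates
(`OR₄ = x₀ ∨ OR₃`, `x₀ ∨ maj3`, …) call for the threefold lattice indicators `[W⊔y₁∈A ∧ W⊔y₂∈A ∧ W⊔y₃∈A]` (`iAnd3`) and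
`[W⊔y₁∈A ∨ W⊔y₂∈A ∨ W⊔y₃∈A]` (`iOr3`), again as indicator polynomials, with their `{0,1}`-valuedness, monotonicity in the first-block point
and the family-inclusion facts against principal indicators (the hypotheses of `krec_facts` / `sum_krec_mul_nonneg`).
HONEST LABEL: bookkeeping only, complete proofs, std axioms. [this work]
-/

namespace Summit.CriticalPhenomena.PercolationContinuityZ3.Theorems

namespace FiveUpSet

open Finset

variable {γ₁ δ : Type} [DecidableEq γ₁] [DecidableEq δ]

/-- `[W⊔y₁ ∈ A ∧ W⊔y₂ ∈ A ∧ W⊔y₃ ∈ A]` as an indicator polynomial. [this work] -/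
def iAnd3 (A : Finset (Finset (γ₁ ⊕ δ))) (y₁ y₂ y₃ : Finset δ) (W : Finset γ₁) : ℤ :=
  ind A (W.disjSum y₁) * ind A (W.disjSum y₂) * ind A (W.disjSum y₃)

/-- `[W⊔y₁ ∈ A ∨ W⊔y₂ ∈ A ∨ W⊔y₃ ∈ A]` as an indicator polynomial `1 − (1−a)(1−b)(1−c)`. [this work] -/
def iOr3 (A : Finset (Finset (γ₁ ⊕ δ))) (y₁ y₂ y₃ : Finset δ) (W : Finset γ₁) : ℤ :=
  1 - (1 - ind A (W.disjSum y₁)) * (1 - ind A (W.disjSum y₂)) * (1 - ind A (W.disjSum y₃))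

/-- `iAnd3` is `0` or `1`. [this work] -/
theorem iAnd3_eq_zero_or_one (A : Finset (Finset (γ₁ ⊕ δ))) (y₁ y₂ y₃ : Finset δ) (W : Finset γ₁) :
    iAnd3 A y₁ y₂ y₃ W = 0 ∨ iAnd3 A y₁ y₂ y₃ W = 1 := by
  unfold iAnd3
  rcases ind_eq_zero_or_one A (W.disjSum y₁) with h₁ | h₁ <;> rcases ind_eq_zero_or_one A (W.disjSum y₂) with h₂ | h₂ <;>
    rcases ind_eq_zero_or_one A (W.disjSum y₃) with h₃ | h₃ <;> simp [h₁, h₂, h₃]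

/-- `iOr3` is `0` or `1`. [this work] -/
theorem iOr3_eq_zero_or_one (A : Finset (Finset (γ₁ ⊕ δ))) (y₁ y₂ y₃ : Finset δ) (W : Finset γ₁) :
    iOr3 A y₁ y₂ y₃ W = 0 ∨ iOr3 A y₁ y₂ y₃ W = 1 := by
  unfold iOr3
  rcases ind_eq_zero_or_one A (W.disjSum y₁) with h₁ | h₁ <;> rcases ind_eq_zero_or_one A (W.disjSum y₂) with h₂ | h₂ <;>
    rcases ind_eq_zero_or_one A (W.disjSum y₃) with h₃ | h₃ <;> simp [h₁, h₂, h₃]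

/-- `iAnd` takes values in `[0,1]`. [this work] -/
theorem iAnd_bounds (A : Finset (Finset (γ₁ ⊕ δ))) (y₁ y₂ : Finset δ) (W : Finset γ₁) : 0 ≤ iAnd A y₁ y₂ W ∧ iAnd A y₁ y₂ W ≤ 1 := by
  rcases iAnd_eq_zero_or_one A y₁ y₂ W with h | h <;> rw [h] <;> norm_num

/-- `iOr` takes values in `[0,1]`. [this work] -/
theorem iOr_bounds (A : Finset (Finset (γ₁ ⊕ δ))) (y₁ y₂ : Finset δ) (W : Finset γ₁) : 0 ≤ iOr A y₁ y₂ W ∧ iOr A y₁ y₂ W ≤ 1 := by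
  rcases iOr_eq_zero_or_one A y₁ y₂ W with h | h <;> rw [h] <;> norm_num

/-- `iAnd3 = iAnd · ind`. [this work] -/
theorem iAnd3_eq (A : Finset (Finset (γ₁ ⊕ δ))) (y₁ y₂ y₃ : Finset δ) (W : Finset γ₁) :
    iAnd3 A y₁ y₂ y₃ W = iAnd A y₁ y₂ W * ind A (W.disjSum y₃) := by unfold iAnd3 iAnd; ring

/-- `iOr3 = iOr + ind − iOr·ind`. [this work] -/
theorem iOr3_eq (A : Finset (Finset (γ₁ ⊕ δ))) (y₁ y₂ y₃ : Finset δ) (W : Finset γ₁) :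
    iOr3 A y₁ y₂ y₃ W = iOr A y₁ y₂ W + ind A (W.disjSum y₃) - iOr A y₁ y₂ W * ind A (W.disjSum y₃) := by unfold iOr3 iOr; ring

section mono
variable {A : Finset (Finset (γ₁ ⊕ δ))} (hA : IsUpperSet (A : Set (Finset (γ₁ ⊕ δ))))
include hA

/-- `iAnd3` is monotone in the first-block point. [this work] -/
theorem iAnd3_mono (y₁ y₂ y₃ : Finset δ) {W W' : Finset γ₁} (h : W ⊆ W') : iAnd3 A y₁ y₂ y₃ W ≤ iAnd3 A y₁ y₂ y₃ W' := by
  rw [iAnd3_eq, iAnd3_eq]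
  have h12 := iAnd_mono hA y₁ y₂ h
  have h3 := ind_mono_pt hA (disjSum_mono h (le_refl y₃))
  have b1 := iAnd_bounds A y₁ y₂ W; have b2 := ind_nonneg_le_one A (W.disjSum y₃)
  have b3 := iAnd_bounds A y₁ y₂ W'; have b4 := ind_nonneg_le_one A (W'.disjSum y₃)
  nlinarith [mul_nonneg b3.1 (sub_nonneg.2 h3), mul_nonneg b2.1 (sub_nonneg.2 h12)]

/-- `iOr3` is monotone in the first-block point. [this work] -/
theorem iOr3_mono (y₁ y₂ y₃ : Finset δ) {W W' : Finset γ₁} (h : W ⊆ W') : iOr3 A y₁ y₂ y₃ W ≤ iOr3 A y₁ y₂ y₃ W' := by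
  rw [iOr3_eq, iOr3_eq]
  have h12 := iOr_mono hA y₁ y₂ h
  have h3 := ind_mono_pt hA (disjSum_mono h (le_refl y₃))
  have b1 := iOr_bounds A y₁ y₂ W; have b2 := ind_nonneg_le_one A (W.disjSum y₃)
  have b3 := iOr_bounds A y₁ y₂ W'; have b4 := ind_nonneg_le_one A (W'.disjSum y₃)
  nlinarith [mul_nonneg (sub_nonneg.2 h12) (sub_nonneg.2 b4.2), mul_nonneg (sub_nonneg.2 h3) (sub_nonneg.2 b1.2)]

/-- Family inclusion: `[y₁∈A_W ∧ y₂∈A_W ∧ y₃∈A_W] ≤ [y∈A_W]` when some `yᵢ ⊆ y`. [this work] -/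
theorem iAnd3_le_ind {y₁ y₂ y₃ y : Finset δ} (h : y₁ ⊆ y ∨ y₂ ⊆ y ∨ y₃ ⊆ y) (W : Finset γ₁) : iAnd3 A y₁ y₂ y₃ W ≤ ind A (W.disjSum y) := by
  unfold iAnd3
  have b1 := ind_nonneg_le_one A (W.disjSum y₁); have b2 := ind_nonneg_le_one A (W.disjSum y₂); have b3 := ind_nonneg_le_one A (W.disjSum y₃)
  have p12 : ind A (W.disjSum y₁) * ind A (W.disjSum y₂) ≤ 1 := mul_le_one₀ b1.2 b2.1 b2.2
  have q12 : 0 ≤ ind A (W.disjSum y₁) * ind A (W.disjSum y₂) := mul_nonneg b1.1 b2.1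
  rcases h with h | h | h
  · have hm := ind_mono_pt hA (disjSum_mono (le_refl W) h)
    nlinarith [mul_nonneg b2.1 b3.1, mul_le_one₀ b2.2 b3.1 b3.2, mul_nonneg (sub_nonneg.2 hm) (mul_nonneg b2.1 b3.1)]
  · have hm := ind_mono_pt hA (disjSum_mono (le_refl W) h)
    nlinarith [mul_nonneg b1.1 b3.1, mul_le_one₀ b1.2 b3.1 b3.2, mul_nonneg (sub_nonneg.2 hm) (mul_nonneg b1.1 b3.1)]
  · have hm := ind_mono_pt hA (disjSum_mono (le_refl W) h)
    nlinarith [mul_nonneg (sub_nonneg.2 hm) q12]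

/-- Family inclusion: `[y∈A_W] ≤ [y₁∈A_W ∧ y₂∈A_W ∧ y₃∈A_W]` when `y ⊆ y₁, y₂, y₃`. [this work] -/
theorem ind_le_iAnd3 {y₁ y₂ y₃ y : Finset δ} (h₁ : y ⊆ y₁) (h₂ : y ⊆ y₂) (h₃ : y ⊆ y₃) (W : Finset γ₁) : ind A (W.disjSum y) ≤ iAnd3 A y₁ y₂ y₃ W := by
  unfold iAnd3
  have hm1 := ind_mono_pt hA (disjSum_mono (le_refl W) h₁); have hm2 := ind_mono_pt hA (disjSum_mono (le_refl W) h₂)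
  have hm3 := ind_mono_pt hA (disjSum_mono (le_refl W) h₃)
  have b1 := ind_nonneg_le_one A (W.disjSum y₁); have b2 := ind_nonneg_le_one A (W.disjSum y₂); have b3 := ind_nonneg_le_one A (W.disjSum y₃)
  rcases ind_eq_zero_or_one A (W.disjSum y) with e | e
  · rw [e]; exact mul_nonneg (mul_nonneg b1.1 b2.1) b3.1
  · rw [e] at hm1 hm2 hm3 ⊢
    rw [le_antisymm b1.2 hm1, le_antisymm b2.2 hm2, le_antisymm b3.2 hm3]; norm_num

/-- Family inclusion: `[y₁∈A_W ∨ y₂∈A_W ∨ y₃∈A_W] ≤ [y∈A_W]` when `y₁, y₂, y₃ ⊆ y`. [this work] -/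
theorem iOr3_le_ind {y₁ y₂ y₃ y : Finset δ} (h₁ : y₁ ⊆ y) (h₂ : y₂ ⊆ y) (h₃ : y₃ ⊆ y) (W : Finset γ₁) : iOr3 A y₁ y₂ y₃ W ≤ ind A (W.disjSum y) := by
  unfold iOr3
  have hm1 := ind_mono_pt hA (disjSum_mono (le_refl W) h₁); have hm2 := ind_mono_pt hA (disjSum_mono (le_refl W) h₂)
  have hm3 := ind_mono_pt hA (disjSum_mono (le_refl W) h₃)
  have b1 := ind_nonneg_le_one A (W.disjSum y₁); have b2 := ind_nonneg_le_one A (W.disjSum y₂); have b3 := ind_nonneg_le_one A (W.disjSum y₃)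
  rcases ind_eq_zero_or_one A (W.disjSum y) with e | e
  · rw [e] at hm1 hm2 hm3 ⊢
    rw [le_antisymm hm1 b1.1, le_antisymm hm2 b2.1, le_antisymm hm3 b3.1]; norm_num
  · rw [e]
    have : 0 ≤ (1 - ind A (W.disjSum y₁)) * (1 - ind A (W.disjSum y₂)) * (1 - ind A (W.disjSum y₃)) :=
      mul_nonneg (mul_nonneg (sub_nonneg.2 b1.2) (sub_nonneg.2 b2.2)) (sub_nonneg.2 b3.2)
    linarith

/-- Family inclusion: `[y∈A_W] ≤ [y₁∈A_W ∨ y₂∈A_W ∨ y₃∈A_W]` when `y ⊆ yᵢ` for some `i`. [this work] -/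
theorem ind_le_iOr3 {y₁ y₂ y₃ y : Finset δ} (h : y ⊆ y₁ ∨ y ⊆ y₂ ∨ y ⊆ y₃) (W : Finset γ₁) : ind A (W.disjSum y) ≤ iOr3 A y₁ y₂ y₃ W := by
  unfold iOr3
  have b1 := ind_nonneg_le_one A (W.disjSum y₁); have b2 := ind_nonneg_le_one A (W.disjSum y₂); have b3 := ind_nonneg_le_one A (W.disjSum y₃)
  have P1 : (1 - ind A (W.disjSum y₁)) * (1 - ind A (W.disjSum y₂)) * (1 - ind A (W.disjSum y₃)) ≤ 1 :=
    mul_le_one₀ (mul_le_one₀ (sub_le_self 1 b1.1) (sub_nonneg.2 b2.2) (sub_le_self 1 b2.1)) (sub_nonneg.2 b3.2) (sub_le_self 1 b3.1)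
  rcases ind_eq_zero_or_one A (W.disjSum y) with e | e
  · rw [e]; linarith
  · rcases h with h | h | h
    · have hm := ind_mono_pt hA (disjSum_mono (le_refl W) h); rw [e] at hm; rw [e, le_antisymm b1.2 hm]; norm_num
    · have hm := ind_mono_pt hA (disjSum_mono (le_refl W) h); rw [e] at hm; rw [e, le_antisymm b2.2 hm]; norm_num
    · have hm := ind_mono_pt hA (disjSum_mono (le_refl W) h); rw [e] at hm; rw [e, le_antisymm b3.2 hm]; norm_num

end mono

end FiveUpSet

end Summit.CriticalPhenomena.PercolationContinuityZ3.Theorems
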